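import Summits.BirchSwinnertonDyer.BirchSwinnertonDyer.Theorems.EisensteinPrimesAnalyticLambdaCongruenceTransfer
import HarnessLib

/-!
# Route `EisensteinPrimes`, line `mudescent`, cruxes 3/5: the analytic inputs of a type-A target from
# a DISPLAYED truncated LINEAR relation between depleted `p`-adic `L`-functions mod `(p, T^K)`
# (the three-curve socket behind (C-Θ); helper)

Seat `bsd-eis-lam-a` g6 (PROGRAMME PART 1b, ACCEL-LIST (4): ANALYTIC side of
`stub_lambdaCount_offLocus`; items stmt-BirchSwinnertonDyer-19033 / -19035; skeleton owner
bsd-eis-ky, `Lines/mudescent.lean`). THEOREMS ONLY — no definition, no named fact, nothing about any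
particular curve; closes nothing; moves no label.

WHAT AND WHY. g5's socket (`EisensteinPrimesAnalyticLambdaCongruenceTransfer`, Greenberg–Vatsal's
(10) as a hypothesis) transfers `μ_an = 0` and `λ_an` from ONE `E[p]`-twin through a displayed
congruence `G·P ≡ u·G′·P′ (mod p, T^K)`. g6's desk finding (HOME/lam-a-g6/lam-a-MEMO-6.md §1, numerical,
conjecture-grade): at `p = 3` the depleted mod-`p` `L`-function, as a function of the Kummer class
`c ∈ H¹(ℚ, 𝔽₃(ω))` of the étale-end `E[3]`, is 𝔽₃-LINEAR in `c` (2 739 / 2 739 collinear class triples,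
0 / 13 359 sign conflicts, rank 181 on 430 classes) — «(C-Θ)». The statement a proof of (C-Θ) would
discharge, and which exact modular-symbol arithmetic discharges per triple today, is a truncated
LINEAR relation `Ḡ·P̄ ≡ a·Ḡ₁P̄₁ + b·Ḡ₂P̄₂ (mod T^K)` in `𝔽_p⟦T⟧` between the target's depleted integral
model and those of two relatives in OTHER classes. This file is the kernel socket for it:

* §1 (`Λ`-algebra): `hasUnitContent_and_lam_add_eq_of_truncEq` — if the reduction of `b·P` agrees
  with a DISPLAYED `ρ ∈ 𝔽_p⟦T⟧` in all coefficients `< K` and `ord_T ρ = m < K`, then `b` has unit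
  content and `λ(b) + ord_T P̄ = m`; `…_of_truncLinComb` — the instance `ρ = a·(b₁P₁)‾ + c·(b₂P₂)‾`.
  (With `c = 0` this is g5's hypothesis shape, except that the order `m` of the right-hand side is
  displayed instead of being derived from the twin's certificate: when `λ(b₁) = λ(b₂)` the order of
  a combination is NOT a function of the two `λ`'s — leading terms may cancel, which is exactly how
  the class `λ` exceeds `min` in MEMO-6 §1 (a).)
* §2 X2: `X2.analyticMuLE_zero_and_analyticLambdaEq_of_truncLinComb` — data `(f, ϖ, L, G)` at a
  multiplicative target `W`, ANY `G₁, G₂, P₁, P₂ ∈ Λ` (intended: the relatives' integral models and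
  Σ₀-Euler products), the displayed relation and order ⟹ `X2.AnalyticMuLE W p 0 ∧ X2.AnalyticLambdaEq W p n`
  with `n + d = m` — both analytic inputs of stubs 3 + 4 at `W`, no `L`-value of `W` read.
* §3 X1: the same in the crux-5 currency (`X1.MuPart.AnalyticMuLE`, `X1.ParitySqueeze.AnalyticLambdaEq`).

HONEST FRAMING. The relation is a HYPOTHESIS, displayed, not asserted; class-wide it is the unprinted
(C-Θ) (MEMO-6 §3: the first-order / `I_Eis/I²_Eis` shape of the + `p`-adic `L`-function at an
Eisenstein maximal ideal; nearest print Pollack–Wake 2025, prime level, `p ≥ 5`). Per triple it is no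
cheaper than a certificate at the target. Its value is reach: relatives in other Kummer classes.

References: [GreenbergVatsal2000] §1 (9)–(10), Thm. (1.4); [Washington1997] §7.1;
HOME/lam-a-g5/lam-a-MEMO-5.md; HOME/lam-a-g6/lam-a-MEMO-6.md §1, §3, §5.
-/

set_option linter.dupNamespace false
set_option autoImplicit false

noncomputable section

open scoped Classical MatrixGroups ModularForm

open PowerSeries CongruenceSubgroup WeierstrassCurve NumberField IsDedekindDomain
  Literature.NumberTheory.EllipticCurves
  Literature.NumberTheory.EllipticCurves.ModularForms
  Literature.NumberTheory.EllipticCurves.Rank1Residual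
  Literature.NumberTheory.EllipticCurves.GreenbergVatsal2000
  Literature.NumberTheory.EllipticCurves.Wuthrich2014
  Summit.BirchSwinnertonDyer.Rank1Residual
  Summit.BirchSwinnertonDyer.Rank1Residual.X1.MuLambda
  Summit.BirchSwinnertonDyer.Rank1Residual.X11a
  Summit.BirchSwinnertonDyer.Rank1Residual.Iwasawa
  Summit.BirchSwinnertonDyer.Rank1Residual.X2.EulerFactorAlgebra
  Summit.BirchSwinnertonDyer.Rank1Residual.X2.EulerFactorInvariants
  Summit.BirchSwinnertonDyer.Rank1Residual.X2.GreenbergVatsalAnalyticTransferCore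
  Summit.BirchSwinnertonDyer.BirchSwinnertonDyer.Theorems
  Summit.BirchSwinnertonDyer.BirchSwinnertonDyer.Theorems.EisensteinPrimesAnalyticLambdaCongruenceTransfer

namespace Summit.BirchSwinnertonDyer.BirchSwinnertonDyer.Theorems.EisensteinPrimesAnalyticLambdaLinearTransfer

variable {p : ℕ} [hp : Fact p.Prime]

/-! ## §1. `Λ`-algebra: a truncated equality with a displayed reduction of known order -/

section Algebra

/-- **Truncated equality with a displayed series ⟹ unit content and `λ`.** If the reduction of
`b·P ∈ Λ` agrees with `ρ ∈ 𝔽_p⟦T⟧` in every coefficient of index `< K`, and `ord_T ρ = m < K`, then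
`b` has unit content (`μ(b) = 0`) and `λ(b) + ord_T P̄ = m`. [cite: GreenbergVatsal2000, §1 (9)–(10) and p. 10]
[cite: Washington1997, §7.1] -/
theorem hasUnitContent_and_lam_add_eq_of_truncEq {b P : IwasawaAlgebra p} {d : ℕ}
    (hd : (PowerSeries.map (PadicInt.toZMod (p := p)) P).order = d)
    {ρ : PowerSeries (ZMod p)} {m K : ℕ}
    (hcong : ∀ j < K,
      PowerSeries.coeff j (PowerSeries.map (PadicInt.toZMod (p := p)) (b * P)) =
        PowerSeries.coeff j ρ)
    (hm : ρ.order = m) (hK : m < K) :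
    HasUnitContent b ∧ lam b + d = m := by
  obtain ⟨hρm, hρlt⟩ := PowerSeries.order_eq_nat.mp hm
  have hord : (PowerSeries.map (PadicInt.toZMod (p := p)) (b * P)).order = m := by
    refine PowerSeries.order_eq_nat.mpr ⟨?_, fun i hi => ?_⟩
    · rw [hcong m hK]
      exact hρm
    · rw [hcong i (hi.trans hK)]
      exact hρlt i hi
  have hne : PowerSeries.map (PadicInt.toZMod (p := p)) (b * P) ≠ 0 := by
    intro h
    rw [h, PowerSeries.order_zero] at hord
    exact ENat.top_ne_coe m hord
  obtain ⟨hb, -⟩ :=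
    (hasUnitContent_mul_iff b P).mp ((hasUnitContent_iff_map_toZMod_ne_zero _).mpr hne)
  refine ⟨hb, ?_⟩
  have h : ((lam b + d : ℕ) : ℕ∞) = m := by
    rw [Nat.cast_add, natCast_lam_eq_order_map_toZMod hb, ← hd, ← PowerSeries.order_mul,
      ← map_mul, hord]
  exact_mod_cast h

/-- **Truncated LINEAR relation ⟹ unit content and `λ`.** If `(b₃P₃)‾ ≡ a·(b₁P₁)‾ + c·(b₂P₂)‾`
coefficientwise in indices `< K` and the right-hand side has `T`-order `m < K` (displayed), then
`b₃` has unit content and `λ(b₃) + ord_T P̄₃ = m`. The case `c = 0` is Greenberg–Vatsal's (10)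
truncated; the order of a genuine combination is not a function of the two `λ`'s (cancellation).
[cite: GreenbergVatsal2000, §1 (9)–(10), Thm. (1.4)] [cite: Washington1997, §7.1] -/
theorem hasUnitContent_and_lam_add_eq_of_truncLinComb {b₁ b₂ b₃ P₁ P₂ P₃ : IwasawaAlgebra p}
    {d₃ : ℕ} (hd₃ : (PowerSeries.map (PadicInt.toZMod (p := p)) P₃).order = d₃)
    {a c : ZMod p} {m K : ℕ}
    (hcong : ∀ j < K,
      PowerSeries.coeff j (PowerSeries.map (PadicInt.toZMod (p := p)) (b₃ * P₃)) =
        a * PowerSeries.coeff j (PowerSeries.map (PadicInt.toZMod (p := p)) (b₁ * P₁)) +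
          c * PowerSeries.coeff j (PowerSeries.map (PadicInt.toZMod (p := p)) (b₂ * P₂)))
    (hm : (a • PowerSeries.map (PadicInt.toZMod (p := p)) (b₁ * P₁) +
        c • PowerSeries.map (PadicInt.toZMod (p := p)) (b₂ * P₂)).order = m)
    (hK : m < K) :
    HasUnitContent b₃ ∧ lam b₃ + d₃ = m := by
  refine hasUnitContent_and_lam_add_eq_of_truncEq hd₃ (fun j hj => ?_) hm hK
  rw [hcong j hj, map_add, PowerSeries.coeff_smul, PowerSeries.coeff_smul, smul_eq_mul,
    smul_eq_mul]

end Algebra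

/-! ## §2. X2: both analytic inputs of stubs 3 + 4 at a multiplicative target -/

section X2

variable {W : WeierstrassCurve ℚ} [W.IsElliptic] [W.IsGloballyMinimal]
  {N : ℕ} [NeZero N] {f : CuspForm (Gamma0 N) 2} {ϖ : ℚ} {L : PowerSeries ℚ_[p]}

/-- **X2: `μ_an(W) = 0` and `λ_an(W) = n` at an odd multiplicative target from a DISPLAYED truncated
linear relation.** Data: `(f, ϖ, L)` the datum of `X2.AnalyticMuLE` / `X2.AnalyticLambdaEq` at
`(W, p)` with an integral model `ι(G) = ϖ·L`; a multiplier `P ∈ Λ` of `T`-order `d` (the Σ₀-Euler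
product); ANY `G₁, G₂, P₁, P₂ ∈ Λ` (the relatives' models and multipliers); the displayed relation
`Ḡ·P̄ ≡ a·Ḡ₁P̄₁ + c·Ḡ₂P̄₂` in indices `< K`, the displayed order `m < K` of its right-hand side, and
`n + d = m`. No `L`-value of `W` is read. [cite: GreenbergVatsal2000, §1 (9)–(10), Thm. (1.4)]
[cite: Washington1997, §7.1] -/
theorem X2.analyticMuLE_zero_and_analyticLambdaEq_of_truncLinComb (hf : IsNewformOf W f)
    (hϖ : (ϖ : ℝ) * W.realPeriodRat = plusPeriod f)
    (hLs : W.HasSplitMultiplicativeReductionAtPrime p → IsSplitMultPAdicLFunctionOf f p L)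
    (hLn : ¬ W.HasSplitMultiplicativeReductionAtPrime p → IsMultPAdicLFunctionOf f p (-1) L)
    {G : IwasawaAlgebra p} (hG : iwasawaToPowerSeries p G = PowerSeries.C ((ϖ : ℚ) : ℚ_[p]) * L)
    {P : IwasawaAlgebra p} {d : ℕ} (hd : (PowerSeries.map (PadicInt.toZMod (p := p)) P).order = d)
    {G₁ G₂ P₁ P₂ : IwasawaAlgebra p} {a c : ZMod p} {m K : ℕ}
    (hcong : ∀ j < K,
      PowerSeries.coeff j (PowerSeries.map (PadicInt.toZMod (p := p)) (G * P)) =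
        a * PowerSeries.coeff j (PowerSeries.map (PadicInt.toZMod (p := p)) (G₁ * P₁)) +
          c * PowerSeries.coeff j (PowerSeries.map (PadicInt.toZMod (p := p)) (G₂ * P₂)))
    (hm : (a • PowerSeries.map (PadicInt.toZMod (p := p)) (G₁ * P₁) +
        c • PowerSeries.map (PadicInt.toZMod (p := p)) (G₂ * P₂)).order = m)
    (hK : m < K) {n : ℕ} (hn : n + d = m) :
    X2.AnalyticMuLE W p 0 ∧ X2.AnalyticLambdaEq W p n := by
  obtain ⟨hGu, hadd⟩ := hasUnitContent_and_lam_add_eq_of_truncLinComb hd hcong hm hK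
  have hlamG : lam G = n := by omega
  obtain ⟨k, hk⟩ := (hasUnitContent_iff_exists_norm_eq_one G).mp hGu
  rw [EisensteinPrimesX2AnalyticLambdaCertificate.norm_coeff_eq_of_iota_eq hG] at hk
  refine ⟨EisensteinPrimesX2AnalyticLambdaCertificate.analyticMuLE_zero_of_norm_coeff_eq_one hf hϖ
      hLs hLn hk,
    (EisensteinPrimesX2AnalyticLambdaCertificate.analyticLambdaEq_iff_of_datum hf hϖ hLs hLn
      n).mpr fun G' hG' ↦ ?_⟩
  rw [iwasawaToPowerSeries_injective p (hG'.trans hG.symm), hlamG]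

end X2

/-! ## §3. X1: the crux-5 currency (good ordinary target) -/

section X1

variable {W : WeierstrassCurve ℚ} [W.IsElliptic] [W.IsGloballyMinimal] [NeZero (W.conductorNorm ℤ)]
  {f : CuspForm (Gamma0 (W.conductorNorm ℤ)) 2} {ϖ : ℚ}

/-- **X1: `X1.MuPart.AnalyticMuLE W p 0 ∧ X1.ParitySqueeze.AnalyticLambdaEq W p n` at a good ordinary
target from a DISPLAYED truncated linear relation** (crux 5 `MazurMCOnX1RankZero`, row A3): as §2
with `ι(G) = ϖ·L_p(f, α)`, `α` the unit root. [cite: GreenbergVatsal2000, §1 (9)–(10), Thm. (1.4)]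
[cite: Washington1997, §7.1] -/
theorem X1.analyticMuLE_zero_and_analyticLambdaEq_of_truncLinComb (hf : IsNewformOf W f)
    (hϖ : (ϖ : ℝ) * W.realPeriodRat = plusPeriod f) {G : IwasawaAlgebra p}
    (hG : iwasawaToPowerSeries p G =
      PowerSeries.C (ϖ : ℚ_[p]) * padicLFunction f (unitRoot W p : ℚ_[p]))
    {P : IwasawaAlgebra p} {d : ℕ} (hd : (PowerSeries.map (PadicInt.toZMod (p := p)) P).order = d)
    {G₁ G₂ P₁ P₂ : IwasawaAlgebra p} {a c : ZMod p} {m K : ℕ}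
    (hcong : ∀ j < K,
      PowerSeries.coeff j (PowerSeries.map (PadicInt.toZMod (p := p)) (G * P)) =
        a * PowerSeries.coeff j (PowerSeries.map (PadicInt.toZMod (p := p)) (G₁ * P₁)) +
          c * PowerSeries.coeff j (PowerSeries.map (PadicInt.toZMod (p := p)) (G₂ * P₂)))
    (hm : (a • PowerSeries.map (PadicInt.toZMod (p := p)) (G₁ * P₁) +
        c • PowerSeries.map (PadicInt.toZMod (p := p)) (G₂ * P₂)).order = m)
    (hK : m < K) {n : ℕ} (hn : n + d = m) :
    X1.MuPart.AnalyticMuLE W p 0 ∧ X1.ParitySqueeze.AnalyticLambdaEq W p n := by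
  obtain ⟨hGu, hadd⟩ := hasUnitContent_and_lam_add_eq_of_truncLinComb hd hcong hm hK
  have hlamG : lam G = n := by omega
  obtain ⟨k, hk⟩ := (hasUnitContent_iff_exists_norm_eq_one G).mp hGu
  rw [EisensteinPrimesX2AnalyticLambdaCertificate.norm_coeff_eq_of_iota_eq hG] at hk
  refine ⟨EisensteinPrimesX1AnalyticLambdaCertificate.analyticMuLE_zero_of_norm_coeff_eq_one hf hϖ hk,
    (EisensteinPrimesX1AnalyticLambdaCertificate.analyticLambdaEq_iff_of_datum hf hϖ n).mpr
      fun G' hG' ↦ ?_⟩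
  rw [iwasawaToPowerSeries_injective p (hG'.trans hG.symm), hlamG]

end X1

end Summit.BirchSwinnertonDyer.BirchSwinnertonDyer.Theorems.EisensteinPrimesAnalyticLambdaLinearTransfer

end
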